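import Summits.Langlands.Langlands.Theses.EllipticDegreeLadder

/-!
# Glue of the layer-2 split of `OffLadderRankTwoAutomorphy` (route EllipticDegreeLadder)

Closes the glue item of `route-Langlands-EllipticDegreeLadder` generated by
`--split OffLadderRankTwoAutomorphy --glue-decl-name OffLadderRankTwoAutomorphy_of_split`:
`OffLadderRankTwoAutomorphy_of_split :
  HighDegreeEllipticAutomorphy → ImQuadFiniteX0FifteenAutomorphy → CMWitnessRestAutomorphy →
    DarkRankTwoAutomorphy → EllipticTransportAnyBase → OffLadderRankTwoAutomorphy`.
Pure logic — three nested excluded middles on the (inlined) dials of the pair (K, ρ): a totally-real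
elliptic sandwich witness of any degree? (yes ⇒ HIGH, which also receives the ambient «off the ladder»);
an imaginary-quadratic witness with X₀(15)(K₀) finite? (yes ⇒ CMFIN); a CM witness at all? (yes ⇒ CMREST,
no ⇒ DARK).  The transport child is not used.  This is the lens-1-g8 node proof
`CMWitnessLadder.OffLadderRankTwoAutomorphy_of_split` (decomp-langlands, 2026-08-30; certified against the
gate render of the split in kit_check.lean, rc 0), transported to the tree's declarations.  No definitions,
no new mathematics.
-/

set_option linter.dupNamespace false -- project-wide option; `Summit.Langlands.Langlands` is the mandated namespace

namespace Summit.Langlands.Langlands.Theorems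

/-- The glue item of the split of `EllipticDegreeLadder.OffLadderRankTwoAutomorphy` (stmt-Langlands-30186):
the four cells HIGH, CMFIN, CMREST, DARK (and the unused transport child) imply the parent box «no elliptic
witness over a totally real field of degree ≤ 5».  Proof: `by_cases` on the three inlined witness predicates. -/
theorem OffLadderRankTwoAutomorphy_of_split_proof :
    Summit.Langlands.Langlands.Theses.EllipticDegreeLadder.OffLadderRankTwoAutomorphy_of_split := by
  intro hH hF hR hD _hT K _ _ hcpt ℓ _ ι ρ hirr hgeo htw hoff
  by_cases hT : (∃ (L : Type) (_ : Field L) (_ : NumberField L) (_ : Algebra K L), IsGalois K L ∧ IsSolvable (L ≃ₐ[K] L) ∧ ∃ (K₀ : Type) (_ : Field K₀) (_ : NumberField K₀) (_ : Algebra K₀ L), IsGalois K₀ L ∧ IsSolvable (L ≃ₐ[K₀] L) ∧ NumberField.IsTotallyReal K₀ ∧ ∃ (E : WeierstrassCurve K₀) (_ : E.IsElliptic) (χ : Literature.NumberTheory.GaloisRepresentations.FramedGaloisRep L (PadicAlgCl ℓ) 1), ∀ g : Field.absoluteGaloisGroup L, Literature.NumberTheory.GaloisRepresentations.FramedRep.trace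 (ρ.restrictField L) g = Literature.NumberTheory.GaloisRepresentations.FramedRep.trace χ g * Literature.NumberTheory.GaloisRepresentations.FramedRep.trace ((E.framedTateGaloisRep ℓ).restrictField L) g)
  · exact hH K hcpt ℓ ι ρ hirr hgeo htw ⟨hoff, hT⟩
  · by_cases hFw : (∃ (L : Type) (_ : Field L) (_ : NumberField L) (_ : Algebra K L), IsGalois K L ∧ IsSolvable (L ≃ₐ[K] L) ∧ ∃ (K₀ : Type) (_ : Field K₀) (_ : NumberField K₀) (_ : Algebra K₀ L), IsGalois K₀ L ∧ IsSolvable (L ≃ₐ[K₀] L) ∧ NumberField.IsCMField K₀ ∧ Module.finrank ℚ K₀ = 2 ∧ Finite ((⟨0, 41, 0, 400, 0⟩ : WeierstrassCurve ℚ).baseChange K₀).toAffine.Point ∧ ∃ (E : WeierstrassCurve K₀) (_ : E.IsElliptic) (χ : Literature.NumberTheory.GaloisRepresentations.FramedGaloisRep L (PadicAlgCl ℓ) 1), ∀ g : Field.absoluteGaloisGroup L, Literature.NumberTheory.GaloisRepresentations.FramedRep.trace (ρ.restrictField L) g = Literature.NumberTheory.GaloisRepresentations.FramedRep.trace χ g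 * Literature.NumberTheory.GaloisRepresentations.FramedRep.trace ((E.framedTateGaloisRep ℓ).restrictField L) g)
    · exact hF K hcpt ℓ ι ρ hirr hgeo htw ⟨hT, hFw⟩
    · by_cases hA : (∃ (L : Type) (_ : Field L) (_ : NumberField L) (_ : Algebra K L), IsGalois K L ∧ IsSolvable (L ≃ₐ[K] L) ∧ ∃ (K₀ : Type) (_ : Field K₀) (_ : NumberField K₀) (_ : Algebra K₀ L), IsGalois K₀ L ∧ IsSolvable (L ≃ₐ[K₀] L) ∧ NumberField.IsCMField K₀ ∧ ∃ (E : WeierstrassCurve K₀) (_ : E.IsElliptic) (χ : Literature.NumberTheory.GaloisRepresentations.FramedGaloisRep L (PadicAlgCl ℓ) 1), ∀ g : Field.absoluteGaloisGroup L, Literature.NumberTheory.GaloisRepresentations.FramedRep.trace (ρ.restrictField L) g = Literature.NumberTheory.GaloisRepresentations.FramedRep.trace χ g * Literature.NumberTheory.GaloisRepresentations.FramedRep.trace ((E.framedTateGaloisRep ℓ).restrictField L) g)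
      · exact hR K hcpt ℓ ι ρ hirr hgeo htw ⟨hT, hFw, hA⟩
      · exact hD K hcpt ℓ ι ρ hirr hgeo htw ⟨hT, hA⟩

end Summit.Langlands.Langlands.Theorems
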